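import Summits.QuantumFields.YangMills.Theorems.FlatTubeReductionRateKappaNear
import Summits.QuantumFields.YangMills.Theorems.FlatTubeReductionRateAlpha
import Summits.QuantumFields.YangMills.Theorems.LuscherReductionTwistedTraceScalingBTProfileRates
import HarnessLib

/-!
# SCHEDULE «R» of the rate twin's dressed (B-T) brick — lane A's schedule-B GEOMETRY (fibre radius `t = R = β^{-1/2}ℓ`, gauge core `R₁ = 5β^{-1/2}ℓ²`, `T = 9L·R₁ + ε`) at the
# rate window `δ = D·recordDelta1 L (1/6)` with the near/far threshold `α = β^{-1/2}ℓ²/(2L²)`: the fact bundle, the first-order rates `ε₁ + ε₂ ≤ 1`, `η ≤ 1`, the near-pair rate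
# `η_s ≤ 1`, and ★★ `κ₀ ≤ a·λ_b(L³β)²` eventually (route `FlatTubeReduction`, crux K1 `NearFlatRatioLaw` stmt-QuantumFields-24720; seat `ym-line-ftr-p1` g16; R2b1 RECORD rung —
# no summit statement is proved here)

WHY (memo `Cruxes/NearFlatRatioLaw/Lines/ratepack-v5-nearpair-g16.md` §2).  The (B-ST)/(B-OD) bricks are shared with lane A, whose profile of record is the truncated stiff Gaussian of
radius `r_B = min(1/40, β^{-1/2}ℓ)`; the dressed (B-T)-rate brick must therefore run at fibre radius `β^{-1/2}ℓ`, which the near-pair-Lipschitz rate (`…OffMagneticNear`,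
`…RateKappaNear`) allows.  With `R = xℓ` the tail prefactor `e^{M₀}` is `e^{O(log²β)}`, so the far-pair decay must be superpolynomial (`α = xℓ²/(2L²)`: signal branch `βm_far ≳ ℓ⁴/(48L)`)
and the off-diagonal tail factor `e^{3Bα²} = e^{3ℓ⁴/(4L)}` is beaten by the near tail `βm_nt ≳ 5ℓ⁴` (`R₁ = 5xℓ²`).  This file: the schedule's elementary facts (§1), lane A's first-order
rates at this schedule via the `βR² ≤ ℓ'²` envelopes of `…BTProfileEnvelopes` with `ℓ' = ℓ²` (§2), the near-pair rate `η_s ≤ 1` and ★★ `eventually_symKappaR_le_bareLambda_sq`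
(`κ₀ ≤ 240C₁²δ⁸ℓ⁸ + K₂x²ℓ²⁰ ≤ a·λ_b²`) via `symEtaNear_le_atom`/`symKappaNear_le_atom` with `ℓ' = ℓ²`, `K = ℓ` (§3).
HONEST FRAMING: real-analysis bookkeeping for a stub of the CONDITIONAL reduction route R2b1; femto rung R2b1 (RECORD label); not infinite volume, not a gap, not Clay.  No defs, no named
facts, no `sorry`.
-/

set_option autoImplicit false

noncomputable section

open MeasureTheory Filter Topology Real
open scoped BigOperators
open Literature.MathematicalPhysics.QuantumFieldTheory
open Literature.MathematicalPhysics.QuantumLattice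

namespace Summit.QuantumFields.YangMills.Theorems.FemtoTransferGap.TwoLattice.ConstTube

open Summit.QuantumFields.YangMills.Theorems.FemtoTransferGap
open Summit.QuantumFields.YangMills.Theorems.FemtoTransferGap.TwoLattice
open Summit.QuantumFields.YangMills.Theorems.FemtoTransferGap.TwoLattice.Avg
open Summit.QuantumFields.YangMills.Theorems.FemtoTransferGap.TwoLattice.Cov

variable {L : ℕ} [NeZero L]

/-! ## §1 The fact bundle of schedule R -/

/-- ★ **Schedule R, elementary facts**, eventually (`x = powScale (1/2)`, `ℓ = btLog`, `δ = D·recordDelta1 L (1/6)`, `T = 9L·(5xℓ²) + btEps`, `α = xℓ²/(2L²)`, `R = xℓ`):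
`β ≥ 1`; `ℓ = log β ≥ 1`; `0 ≤ δ ≤ 14(D·β^{-1/6})`, `δ ≤ 1/2`; `0 < x ≤ 1`, `βx² = 1`; `0 ≤ T ≤ 46Lxℓ²`, `T ≤ 1/30`, `βT² ≤ 2116L²(ℓ²)²`; `xℓ ≤ T`; `β(xℓ)² = ℓ² ≤ (ℓ²)²`;
`0 ≤ σ := 12L³δ⁴ < 2`, `σ ≤ 12L³δ²`, `√σ ≤ 4L²δ²`; `β(btEps·|Site|) = |Site|`; `0 ≤ α ≤ xℓ²`, `6x ≤ α`, `α ≤ 1/30`; `xℓ² ≤ 1`, `btEps ≤ x`. [folklore] -/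
theorem eventually_scheduleR_facts {D : ℝ} (hD : 1 ≤ D) :
    ∀ᶠ β : ℝ in atTop, 1 ≤ β ∧ btLog β = Real.log β ∧ 1 ≤ btLog β ∧
      0 ≤ D * recordDelta1 L (1 / 6) β ∧ D * recordDelta1 L (1 / 6) β ≤ 14 * (D * powScale (1 / 6) β) ∧ D * recordDelta1 L (1 / 6) β ≤ 1 / 2 ∧
      0 < powScale (1 / 2) β ∧ powScale (1 / 2) β ≤ 1 ∧ β * powScale (1 / 2) β ^ 2 = 1 ∧
      0 ≤ 9 * L * (5 * (powScale (1 / 2) β * btLog β ^ 2)) + btEps β ∧ 9 * L * (5 * (powScale (1 / 2) β * btLog β ^ 2)) + btEps β ≤ 46 * L * powScale (1 / 2) β * btLog β ^ 2 ∧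
      9 * L * (5 * (powScale (1 / 2) β * btLog β ^ 2)) + btEps β ≤ 1 / 30 ∧
      β * (9 * L * (5 * (powScale (1 / 2) β * btLog β ^ 2)) + btEps β) ^ 2 ≤ 2116 * (L : ℝ) ^ 2 * (btLog β ^ 2) ^ 2 ∧
      btLog β * powScale (1 / 2) β ≤ 9 * L * (5 * (powScale (1 / 2) β * btLog β ^ 2)) + btEps β ∧
      β * (btLog β * powScale (1 / 2) β) ^ 2 ≤ (btLog β ^ 2) ^ 2 ∧
      0 ≤ (L : ℝ) ^ 3 * (12 * (D * recordDelta1 L (1 / 6) β) ^ 4) ∧ (L : ℝ) ^ 3 * (12 * (D * recordDelta1 L (1 / 6) β) ^ 4) < 2 ∧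
      (L : ℝ) ^ 3 * (12 * (D * recordDelta1 L (1 / 6) β) ^ 4) ≤ 12 * (L : ℝ) ^ 3 * (D * recordDelta1 L (1 / 6) β) ^ 2 ∧
      Real.sqrt ((L : ℝ) ^ 3 * (12 * (D * recordDelta1 L (1 / 6) β) ^ 4)) ≤ 4 * (L : ℝ) ^ 2 * (D * recordDelta1 L (1 / 6) β) ^ 2 ∧
      β * (btEps β * Fintype.card (Site 3 L)) = (Fintype.card (Site 3 L) : ℝ) ∧
      0 ≤ powScale (1 / 2) β * btLog β ^ 2 / (2 * (L : ℝ) ^ 2) ∧ powScale (1 / 2) β * btLog β ^ 2 / (2 * (L : ℝ) ^ 2) ≤ powScale (1 / 2) β * btLog β ^ 2 ∧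
      6 * powScale (1 / 2) β ≤ powScale (1 / 2) β * btLog β ^ 2 / (2 * (L : ℝ) ^ 2) ∧ powScale (1 / 2) β * btLog β ^ 2 / (2 * (L : ℝ) ^ 2) ≤ 1 / 30 ∧
      powScale (1 / 2) β * btLog β ^ 2 ≤ 1 ∧ btEps β ≤ powScale (1 / 2) β := by
  have hL1 : (1 : ℝ) ≤ L := by exact_mod_cast NeZero.one_le
  have hL0 : (0 : ℝ) < L := by linarith
  have hN : (0 : ℝ) < Fintype.card (Site 3 L) := by exact_mod_cast Fintype.card_pos
  have t46 := (tendsto_powScale_mul_btLog_pow (show (0 : ℝ) < 1 / 2 by norm_num) 2).const_mul (46 * (L : ℝ))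
  rw [mul_zero] at t46
  filter_upwards [eventually_rate_schedule_facts₂ (L := L) hD, eventually_small_elementary_D (L := L) hD, eventually_rate_schedule_facts (L := L) hD,
    t46.eventually (eventually_le_nhds (show (0 : ℝ) < 1 / 30 by norm_num)), Real.tendsto_log_atTop.eventually_ge_atTop (12 * (L : ℝ) ^ 2)]
    with β hf hel hf1 h46 hℓ12
  obtain ⟨hβ1, hℓeq, hℓ1, -, hδ0, hδp, -, hx0, hx1, -, -, -, -, -, -, hσ0, -, hσδ, hsσ, hΓ, -, -⟩ := hf
  obtain ⟨-, hδhalf, -, -, -, hσ2, -⟩ := hel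
  obtain ⟨-, -, -, -, hεx, -⟩ := hf1
  have hx0' : 0 < powScale (1 / 2) β := powScale_pos _ _
  have hℓ0 : 0 ≤ btLog β := by linarith
  have hl2 : (1 : ℝ) ≤ btLog β ^ 2 := one_le_pow₀ hℓ1
  have hl12 : btLog β ≤ btLog β ^ 2 := le_self_pow₀ hℓ1 (by norm_num)
  have hβx : β * powScale (1 / 2) β ^ 2 = 1 := mul_powScale_half_sq hβ1
  have hε0 : 0 < btEps β := powScale_pos _ _
  have hxl2_0 : 0 ≤ powScale (1 / 2) β * btLog β ^ 2 := by positivity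
  have h46' : 46 * L * powScale (1 / 2) β * btLog β ^ 2 ≤ 1 / 30 := by
    have e : 46 * (L : ℝ) * powScale (1 / 2) β * btLog β ^ 2 = 46 * L * (powScale (1 / 2) β * btLog β ^ 2) := by ring
    rw [e]; exact h46
  have h46L : powScale (1 / 2) β * btLog β ^ 2 ≤ 46 * L * powScale (1 / 2) β * btLog β ^ 2 := by
    have h1 : (1 : ℝ) ≤ 46 * L := by linarith
    have h2 := mul_le_mul_of_nonneg_right h1 hxl2_0
    have e : 46 * (L : ℝ) * (powScale (1 / 2) β * btLog β ^ 2) = 46 * L * powScale (1 / 2) β * btLog β ^ 2 := by ring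
    rw [one_mul, e] at h2; exact h2
  -- `T`
  have hT0 : 0 ≤ 9 * L * (5 * (powScale (1 / 2) β * btLog β ^ 2)) + btEps β := by positivity
  have hTx : 9 * L * (5 * (powScale (1 / 2) β * btLog β ^ 2)) + btEps β ≤ 46 * L * powScale (1 / 2) β * btLog β ^ 2 := by
    have h1 : btEps β ≤ powScale (1 / 2) β * btLog β ^ 2 := hεx.trans (le_mul_of_one_le_right hx0 hl2)
    have h2 : powScale (1 / 2) β * btLog β ^ 2 ≤ L * (powScale (1 / 2) β * btLog β ^ 2) := le_mul_of_one_le_left hxl2_0 hL1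
    have e : 46 * (L : ℝ) * powScale (1 / 2) β * btLog β ^ 2 = 9 * L * (5 * (powScale (1 / 2) β * btLog β ^ 2)) + L * (powScale (1 / 2) β * btLog β ^ 2) := by ring
    rw [e]; linarith
  have hT30 : 9 * L * (5 * (powScale (1 / 2) β * btLog β ^ 2)) + btEps β ≤ 1 / 30 := hTx.trans h46'
  have hT2 : β * (9 * L * (5 * (powScale (1 / 2) β * btLog β ^ 2)) + btEps β) ^ 2 ≤ 2116 * (L : ℝ) ^ 2 * (btLog β ^ 2) ^ 2 := by
    have h := pow_le_pow_left₀ hT0 hTx 2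
    calc β * (9 * L * (5 * (powScale (1 / 2) β * btLog β ^ 2)) + btEps β) ^ 2 ≤ β * (46 * L * powScale (1 / 2) β * btLog β ^ 2) ^ 2 :=
          mul_le_mul_of_nonneg_left h (by linarith)
      _ = 2116 * (L : ℝ) ^ 2 * (btLog β ^ 2) ^ 2 * (β * powScale (1 / 2) β ^ 2) := by ring
      _ = 2116 * (L : ℝ) ^ 2 * (btLog β ^ 2) ^ 2 := by rw [hβx, mul_one]
  have htT : btLog β * powScale (1 / 2) β ≤ 9 * L * (5 * (powScale (1 / 2) β * btLog β ^ 2)) + btEps β := by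
    have h1 : btLog β * powScale (1 / 2) β ≤ powScale (1 / 2) β * btLog β ^ 2 := by rw [mul_comm]; exact mul_le_mul_of_nonneg_left hl12 hx0
    have h2 : powScale (1 / 2) β * btLog β ^ 2 ≤ 9 * L * (5 * (powScale (1 / 2) β * btLog β ^ 2)) := by
      have h3 : (1 : ℝ) ≤ 9 * L * 5 := by nlinarith
      have := mul_le_mul_of_nonneg_right h3 hxl2_0
      have e : 9 * (L : ℝ) * 5 * (powScale (1 / 2) β * btLog β ^ 2) = 9 * L * (5 * (powScale (1 / 2) β * btLog β ^ 2)) := by ring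
      rw [one_mul, e] at this; exact this
    linarith [hε0.le]
  have hβR : β * (btLog β * powScale (1 / 2) β) ^ 2 ≤ (btLog β ^ 2) ^ 2 := by
    calc β * (btLog β * powScale (1 / 2) β) ^ 2 = btLog β ^ 2 * (β * powScale (1 / 2) β ^ 2) := by ring
      _ = btLog β ^ 2 := by rw [hβx, mul_one]
      _ ≤ (btLog β ^ 2) ^ 2 := le_self_pow₀ hl2 (by norm_num)
  -- `α`
  have hL2 : (0 : ℝ) < 2 * (L : ℝ) ^ 2 := by positivity
  have hL21 : (1 : ℝ) ≤ 2 * (L : ℝ) ^ 2 := by nlinarith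
  have hα0 : 0 ≤ powScale (1 / 2) β * btLog β ^ 2 / (2 * (L : ℝ) ^ 2) := div_nonneg hxl2_0 hL2.le
  have hαle : powScale (1 / 2) β * btLog β ^ 2 / (2 * (L : ℝ) ^ 2) ≤ powScale (1 / 2) β * btLog β ^ 2 := div_le_self hxl2_0 hL21
  have hαL : 6 * powScale (1 / 2) β ≤ powScale (1 / 2) β * btLog β ^ 2 / (2 * (L : ℝ) ^ 2) := by
    rw [le_div_iff₀ hL2]
    have hℓ12' : 12 * (L : ℝ) ^ 2 ≤ btLog β := by rw [hℓeq]; exact hℓ12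
    have h1 : 12 * (L : ℝ) ^ 2 ≤ btLog β ^ 2 := hℓ12'.trans hl12
    have h2 := mul_le_mul_of_nonneg_left h1 hx0
    have e : 6 * powScale (1 / 2) β * (2 * (L : ℝ) ^ 2) = powScale (1 / 2) β * (12 * (L : ℝ) ^ 2) := by ring
    rw [e]; exact h2
  have hxl2_1 : powScale (1 / 2) β * btLog β ^ 2 ≤ 1 := h46L.trans (h46'.trans (by norm_num))
  have hα30 : powScale (1 / 2) β * btLog β ^ 2 / (2 * (L : ℝ) ^ 2) ≤ 1 / 30 := hαle.trans (h46L.trans h46')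
  exact ⟨hβ1, hℓeq, hℓ1, hδ0, hδp, hδhalf, hx0', hx1, hβx, hT0, hTx, hT30, hT2, htT, hβR, hσ0, hσ2, hσδ, hsσ, hΓ, hα0, hαle, hαL, hα30, hxl2_1, hεx⟩

/-! ## §2 Lane A's first-order rates at schedule R are `≤ 1` eventually -/

omit [NeZero L] in
/-- The atom `(D²β^{-1/3} + β^{-1/2})·ℓ⁸ → 0`. [folklore] -/
theorem tendsto_btW8_D (D : ℝ) : Tendsto (fun β : ℝ => (D ^ 2 * powScale (1 / 3) β + powScale (1 / 2) β) * (btLog β ^ 2) ^ 4) atTop (𝓝 0) := by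
  have h := ((tendsto_powScale_mul_btLog_pow (show (0 : ℝ) < 1 / 3 by norm_num) 8).const_mul (D ^ 2)).add
    (tendsto_powScale_mul_btLog_pow (show (0 : ℝ) < 1 / 2 by norm_num) 8)
  rw [mul_zero, add_zero] at h
  exact h.congr' (Eventually.of_forall fun β => by ring)

/-- ★ **`ε₁ + ε₂ ≤ 1` eventually at schedule R** (`δ = D·recordDelta1 L (1/6)`, `T = 9L(5xℓ²) + ε`, `R = xℓ`). [folklore] -/
theorem eventually_coreEps_sum_le_one_R {D : ℝ} (hD : 1 ≤ D) :
    ∀ᶠ β : ℝ in atTop,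
      coreEps1 L β (D * recordDelta1 L (1 / 6) β) (9 * L * (5 * (powScale (1 / 2) β * btLog β ^ 2)) + btEps β) (btLog β * powScale (1 / 2) β) +
          coreEps2 L β (D * recordDelta1 L (1 / 6) β) (9 * L * (5 * (powScale (1 / 2) β * btLog β ^ 2)) + btEps β) (btLog β * powScale (1 / 2) β)
            ((L : ℝ) ^ 3 * (12 * (D * recordDelta1 L (1 / 6) β) ^ 4)) ≤ 1 := by
  set A : ℝ := 2116 * (L : ℝ) ^ 2 with hA
  have hA0 : 0 ≤ A := by rw [hA]; positivity
  obtain ⟨K₁, hK₁⟩ : ∃ K₁ : ℝ, K₁ = 14 * (288 * (Fintype.card (Edge 3 L) : ℝ) * A + 160 * (Fintype.card (Plaquette 3 L × Fin 3) : ℝ)) := ⟨_, rfl⟩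
  obtain ⟨K₂, hK₂⟩ : ∃ K₂ : ℝ, K₂ = 576 * 196 * (Fintype.card (Edge 3 L) : ℝ) * A + 50 * (12 * 196 * (L : ℝ) ^ 3) * (Fintype.card (Plaquette 3 L × Fin 3) : ℝ) +
      (Fintype.card (Plaquette 3 L) : ℝ) * (1728 * (4 * 196 * A * (L : ℝ) ^ 2) + 29376 * (46 * A * L) + 700569 * (2116 * A * (L : ℝ) ^ 2)) +
      (Fintype.card (Plaquette 3 L) : ℝ) * (29376 * (46 * A * L) + 700569 * (2116 * A * (L : ℝ) ^ 2)) + 145000000 * 196 * (Fintype.card (Plaquette 3 L × Fin 3) : ℝ) := ⟨_, rfl⟩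
  have hK₁0 : 0 ≤ K₁ := by rw [hK₁]; positivity
  have hK₂0 : 0 ≤ K₂ := by rw [hK₂]; positivity
  -- `K₁·(Dβ^{-1/6})ℓ⁴ → 0`, `K₂·(D²β^{-1/3} + x)ℓ⁸ → 0`
  have t₁ : Tendsto (fun β : ℝ => K₁ * ((D * powScale (1 / 6) β) * (btLog β ^ 2) ^ 2)) atTop (𝓝 0) := by
    have h := ((tendsto_powScale_mul_btLog_pow (show (0 : ℝ) < 1 / 6 by norm_num) 4).const_mul D).const_mul K₁
    rw [mul_zero, mul_zero] at h
    exact h.congr' (Eventually.of_forall fun β => by ring)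
  have t₂ := (tendsto_btW8_D D).const_mul K₂
  rw [mul_zero] at t₂
  filter_upwards [eventually_scheduleR_facts (L := L) hD, t₁.eventually (eventually_le_nhds (show (0 : ℝ) < 1 / 2 by norm_num)),
    t₂.eventually (eventually_le_nhds (show (0 : ℝ) < 1 / 2 by norm_num))] with β h c₁ c₂
  obtain ⟨hβ1, -, hℓ1, hδ0, hδp, -, hx0, hx1, -, hT0, hTx, -, hT2, -, hβR, -, -, hσδ, hsσ, -⟩ := h
  have hβ0 : 0 ≤ β := by linarith
  have hl2 : (1 : ℝ) ≤ btLog β ^ 2 := one_le_pow₀ hℓ1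
  have hp2 : (D * powScale (1 / 6) β) ^ 2 = D ^ 2 * powScale (1 / 3) β := by
    have h16 : powScale (1 / 6) β ^ 2 = powScale (1 / 3) β := by
      rw [powScale_eq hβ1, powScale_eq hβ1, ← Real.rpow_mul_natCast hβ0]; norm_num
    rw [mul_pow, h16]
  have h1 := coreEps1_le_atom' (L := L) (A := A) hβ0 hδ0 hδp hT2 hβR
  have h2 := coreEps2_le_atom' (L := L) hβ0 hδ0 hδp hl2 hx0.le hx1 hT0 hTx hT2 hA0 hβR hσδ hsσ
  rw [← hK₁] at h1
  rw [← hK₂, hp2] at h2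
  linarith

/-- ★ **`η ≤ 1` (lane A's first-order near-pair rate) eventually at schedule R**, for the threshold `α = xℓ²/(2L²)`. [folklore] -/
theorem eventually_coreEta_le_one_R {D : ℝ} (hD : 1 ≤ D) :
    ∀ᶠ β : ℝ in atTop,
      coreEta L β (D * recordDelta1 L (1 / 6) β) (powScale (1 / 2) β * btLog β ^ 2 / (2 * (L : ℝ) ^ 2)) (9 * L * (5 * (powScale (1 / 2) β * btLog β ^ 2)) + btEps β)
        (btLog β * powScale (1 / 2) β) (btEps β * Fintype.card (Site 3 L)) ((L : ℝ) ^ 3 * (12 * (D * recordDelta1 L (1 / 6) β) ^ 4)) ≤ 1 := by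
  set A : ℝ := 2116 * (L : ℝ) ^ 2 with hA
  have hA0 : 0 ≤ A := by rw [hA]; positivity
  set N : ℝ := (Fintype.card (Site 3 L) : ℝ) with hNdef
  have hN0 : 0 ≤ N := Nat.cast_nonneg _
  obtain ⟨K, hK⟩ : ∃ K : ℝ, K = (Fintype.card (Edge 3 L) : ℝ) * (558 * A + 192 * A) + 216 * N + 50 * (Fintype.card (Plaquette 3 L × Fin 3) : ℝ) * (12 * 196 * (L : ℝ) ^ 3) +
      (Fintype.card (Plaquette 3 L) : ℝ) * (1728 * (4 * 196 * A * (L : ℝ) ^ 2) + 29376 * (46 * A * L) + 700569 * (2116 * A * (L : ℝ) ^ 2)) +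
      5040 * (Fintype.card (Plaquette 3 L × Fin 3) : ℝ) := ⟨_, rfl⟩
  have t := (tendsto_btW8_D D).const_mul K
  rw [mul_zero] at t
  filter_upwards [eventually_scheduleR_facts (L := L) hD, t.eventually (eventually_le_nhds (show (0 : ℝ) < 1 by norm_num))] with β h c
  obtain ⟨hβ1, -, hℓ1, hδ0, hδp, hδhalf, hx0, hx1, -, hT0, hTx, -, hT2, -, hβR, -, -, hσδ, hsσ, hΓ, hα0, hαle, -⟩ := h
  have hβ0 : 0 ≤ β := by linarith
  have hl2 : (1 : ℝ) ≤ btLog β ^ 2 := one_le_pow₀ hℓ1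
  have hδ1 : D * recordDelta1 L (1 / 6) β ≤ 1 := by linarith
  have hp2 : (D * powScale (1 / 6) β) ^ 2 = D ^ 2 * powScale (1 / 3) β := by
    have h16 : powScale (1 / 6) β ^ 2 = powScale (1 / 3) β := by
      rw [powScale_eq hβ1, powScale_eq hβ1, ← Real.rpow_mul_natCast hβ0]; norm_num
    rw [mul_pow, h16]
  have h := coreEta_le_atom' (L := L) (N := N) hβ0 hδ0 hδp hδ1 hl2 hx0.le hx1 hT0 hTx hT2 hA0 hβR hσδ hsσ hα0 hαle
    (mul_nonneg (btEps_pos_le β).1.le (Nat.cast_nonneg _)) hΓ.le hN0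
  rw [← hK, hp2] at h
  linarith

/-! ## §3 The near-pair rate at schedule R: `η_s ≤ 1` and ★★ `κ₀ ≤ a·λ_b(L³β)²` -/

/-- `δ⁴ℓ^k ≤ 1` at the rate window once `β^{-2/3}ℓ^k ≤ (|Site|/(14D))⁴`. [folklore] -/
theorem delta_four_mul_log_pow_le_one {D β : ℝ} (k : ℕ) (hβ1 : 1 ≤ β) (hD : 0 < D)
    (h : powScale (2 / 3) β * btLog β ^ k ≤ ((Fintype.card (Site 3 L) : ℝ) / (14 * D)) ^ 4) :
    (D * recordDelta1 L (1 / 6) β) ^ 4 * btLog β ^ k ≤ 1 := by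
  have hβ0 : 0 ≤ β := by linarith
  have hN : (0 : ℝ) < (Fintype.card (Site 3 L) : ℝ) := by exact_mod_cast Fintype.card_pos
  have hc : 0 < 14 * D / (Fintype.card (Site 3 L) : ℝ) := by positivity
  have e16 : powScale (1 / 6) β ^ 4 = powScale (2 / 3) β := by
    rw [powScale_eq hβ1, powScale_eq hβ1, ← Real.rpow_mul_natCast hβ0, show (-(1 / 6 : ℝ)) * ((4 : ℕ) : ℝ) = -(2 / 3 : ℝ) by norm_num]
  have e2 : (D * recordDelta1 L (1 / 6) β) ^ 4 = (14 * D / (Fintype.card (Site 3 L) : ℝ)) ^ 4 * powScale (2 / 3) β := by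
    unfold recordDelta1
    rw [show D * (14 * powScale (1 / 6) β / (Fintype.card (Site 3 L) : ℝ)) = (14 * D / (Fintype.card (Site 3 L) : ℝ)) * powScale (1 / 6) β by ring, mul_pow, e16]
  have hinv : ((Fintype.card (Site 3 L) : ℝ) / (14 * D)) ^ 4 = ((14 * D / (Fintype.card (Site 3 L) : ℝ)) ^ 4)⁻¹ := by
    rw [← inv_pow, inv_div]
  rw [e2, mul_assoc]
  rw [hinv] at h
  have h2 := mul_le_mul_of_nonneg_left h (pow_pos hc 4).le
  rwa [mul_inv_cancel₀ (pow_pos hc 4).ne'] at h2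

/-- `x²ℓ^k ≤ δ⁴` at the rate window once `β^{-1/3}ℓ^k ≤ (14D/|Site|)⁴`. [folklore] -/
theorem powScale_half_sq_mul_log_pow_le_delta_four' {D β : ℝ} (k : ℕ) (hβ1 : 1 ≤ β)
    (h : powScale (1 / 3) β * btLog β ^ k ≤ (14 * D / (Fintype.card (Site 3 L) : ℝ)) ^ 4) :
    powScale (1 / 2) β ^ 2 * btLog β ^ k ≤ (D * recordDelta1 L (1 / 6) β) ^ 4 := by
  have hβ0 : 0 ≤ β := by linarith
  have hβpos : 0 < β := by linarith
  have e1 : powScale (1 / 2) β ^ 2 = powScale (2 / 3) β * powScale (1 / 3) β := by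
    rw [powScale_eq hβ1, powScale_eq hβ1, powScale_eq hβ1, ← Real.rpow_mul_natCast hβ0, ← Real.rpow_add hβpos,
      show (-(1 / 2 : ℝ)) * ((2 : ℕ) : ℝ) = -(2 / 3 : ℝ) + -(1 / 3 : ℝ) by norm_num]
  have e16 : powScale (1 / 6) β ^ 4 = powScale (2 / 3) β := by
    rw [powScale_eq hβ1, powScale_eq hβ1, ← Real.rpow_mul_natCast hβ0, show (-(1 / 6 : ℝ)) * ((4 : ℕ) : ℝ) = -(2 / 3 : ℝ) by norm_num]
  have e2 : (D * recordDelta1 L (1 / 6) β) ^ 4 = (14 * D / (Fintype.card (Site 3 L) : ℝ)) ^ 4 * powScale (2 / 3) β := by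
    unfold recordDelta1
    rw [show D * (14 * powScale (1 / 6) β / (Fintype.card (Site 3 L) : ℝ)) = (14 * D / (Fintype.card (Site 3 L) : ℝ)) * powScale (1 / 6) β by ring, mul_pow, e16]
  rw [e1, e2, mul_assoc, mul_comm ((14 * D / (Fintype.card (Site 3 L) : ℝ)) ^ 4)]
  exact mul_le_mul_of_nonneg_left h (powScale_pos _ _).le

/-- ★ **`η_s ≤ 1` eventually at schedule R** (fibre radius `xℓ` in the `t, R` slots; `symEtaNear_le_atom` with `ℓ' = ℓ²`, `K = ℓ`). [folklore] -/
theorem eventually_symEtaR_le_one {D : ℝ} (hD : 1 ≤ D) :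
    ∀ᶠ β : ℝ in atTop,
      β * ((Fintype.card (Edge 3 L) : ℝ) * (558 * (powScale (1 / 2) β * btLog β ^ 2 / (2 * (L : ℝ) ^ 2)) ^ 2 * (9 * L * (5 * (powScale (1 / 2) β * btLog β ^ 2)) + btEps β) ^ 2 +
            192 * (powScale (1 / 2) β * btLog β ^ 2 / (2 * (L : ℝ) ^ 2)) * (9 * L * (5 * (powScale (1 / 2) β * btLog β ^ 2)) + btEps β) ^ 2) +
            216 * (powScale (1 / 2) β * btLog β ^ 2 / (2 * (L : ℝ) ^ 2)) * (D * recordDelta1 L (1 / 6) β) * (btEps β * Fintype.card (Site 3 L))) +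
          β / 2 * (100 * ((L : ℝ) ^ 3 * (12 * (D * recordDelta1 L (1 / 6) β) ^ 4)) * (Fintype.card (Plaquette 3 L × Fin 3) : ℝ) * (btLog β * powScale (1 / 2) β) ^ 2 +
            10080 * (powScale (1 / 2) β * btLog β ^ 2 / (2 * (L : ℝ) ^ 2)) * (Fintype.card (Plaquette 3 L × Fin 3) : ℝ) * (btLog β * powScale (1 / 2) β) ^ 2 +
            (Fintype.card (Plaquette 3 L) : ℝ) * (58752 * (btLog β * powScale (1 / 2) β) ^ 3 + 1401138 * (btLog β * powScale (1 / 2) β) ^ 4 +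
              10000000 * (powScale (1 / 2) β * btLog β ^ 2 / (2 * (L : ℝ) ^ 2)) * (btLog β * powScale (1 / 2) β) ^ 2)) ≤ 1 := by
  have hN : (0 : ℝ) < (Fintype.card (Site 3 L) : ℝ) := by exact_mod_cast Fintype.card_pos
  obtain ⟨C₁, hC₁⟩ : ∃ C₁ : ℝ, C₁ = 600 * (Fintype.card (Plaquette 3 L × Fin 3) : ℝ) * (L : ℝ) ^ 3 := ⟨_, rfl⟩
  obtain ⟨C₂, hC₂⟩ : ∃ C₂ : ℝ, C₂ = (Fintype.card (Edge 3 L) : ℝ) * (558 * 1 ^ 2 * (2116 * (L : ℝ) ^ 2) + 192 * 1 * (2116 * (L : ℝ) ^ 2)) + 216 * 1 * (Fintype.card (Site 3 L) : ℝ) +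
      5040 * 1 * (Fintype.card (Plaquette 3 L × Fin 3) : ℝ) + (Fintype.card (Plaquette 3 L) : ℝ) * (29376 + 700569 + 5000000 * 1) := ⟨_, rfl⟩
  have hδt : Tendsto (fun β : ℝ => D * recordDelta1 L (1 / 6) β) atTop (𝓝 0) := by
    simpa using (tendsto_recordDelta1 (L := L) (show (0 : ℝ) < 1 / 6 by norm_num)).const_mul D
  have hℓ' : Tendsto (fun β : ℝ => C₁ * ((D * recordDelta1 L (1 / 6) β) ^ 4 * (btLog β ^ 2) ^ 2) + C₂ * (powScale (1 / 2) β * (btLog β ^ 2) ^ 5)) atTop (𝓝 0) := by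
    -- `δ⁴ℓ⁴ = (14D/|Site|)⁴·β^{-2/3}ℓ⁴ → 0` and `xℓ¹⁰ → 0`
    have h1 : Tendsto (fun β : ℝ => (14 * D / (Fintype.card (Site 3 L) : ℝ)) ^ 4 * (powScale (2 / 3) β * btLog β ^ 4)) atTop (𝓝 0) := by
      have := (tendsto_powScale_mul_btLog_pow (show (0 : ℝ) < 2 / 3 by norm_num) 4).const_mul ((14 * D / (Fintype.card (Site 3 L) : ℝ)) ^ 4)
      rwa [mul_zero] at this
    have h1' : Tendsto (fun β : ℝ => (D * recordDelta1 L (1 / 6) β) ^ 4 * (btLog β ^ 2) ^ 2) atTop (𝓝 0) := by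
      refine h1.congr' ?_
      filter_upwards [eventually_ge_atTop (1 : ℝ)] with β hβ1
      have hβ0 : 0 ≤ β := by linarith
      have e16 : powScale (1 / 6) β ^ 4 = powScale (2 / 3) β := by
        rw [powScale_eq hβ1, powScale_eq hβ1, ← Real.rpow_mul_natCast hβ0, show (-(1 / 6 : ℝ)) * ((4 : ℕ) : ℝ) = -(2 / 3 : ℝ) by norm_num]
      unfold recordDelta1
      rw [show D * (14 * powScale (1 / 6) β / (Fintype.card (Site 3 L) : ℝ)) = (14 * D / (Fintype.card (Site 3 L) : ℝ)) * powScale (1 / 6) β by ring, mul_pow, e16]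
      ring
    have h2 : Tendsto (fun β : ℝ => powScale (1 / 2) β * (btLog β ^ 2) ^ 5) atTop (𝓝 0) := by
      refine (tendsto_powScale_mul_btLog_pow (show (0 : ℝ) < 1 / 2 by norm_num) 10).congr' (Eventually.of_forall fun β => by ring)
    have := (h1'.const_mul C₁).add (h2.const_mul C₂)
    simpa using this
  filter_upwards [eventually_scheduleR_facts (L := L) hD, hℓ'.eventually (eventually_le_nhds one_pos)] with β h hs
  obtain ⟨hβ1, -, hℓ1, hδ0, -, hδhalf, hx0, hx1, hβx, -, -, -, hT2, -, -, -, -, -, -, hΓ, hα0, hαle, -, -, hxl2_1, -⟩ := h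
  have hβ0 : 0 ≤ β := by linarith
  have hl2 : (1 : ℝ) ≤ btLog β ^ 2 := one_le_pow₀ hℓ1
  have hl12 : btLog β ≤ btLog β ^ 2 := le_self_pow₀ hℓ1 (by norm_num)
  have hδ1 : D * recordDelta1 L (1 / 6) β ≤ 1 := by linarith
  have hΓ0 : 0 ≤ btEps β * (Fintype.card (Site 3 L) : ℝ) := mul_nonneg (powScale_pos _ _).le hN.le
  have hAT : (0 : ℝ) ≤ 2116 * (L : ℝ) ^ 2 := by positivity
  have hα1 : powScale (1 / 2) β * btLog β ^ 2 / (2 * (L : ℝ) ^ 2) ≤ 1 * powScale (1 / 2) β * btLog β ^ 2 := by rw [one_mul]; exact hαle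
  have hσδ : (L : ℝ) ^ 3 * (12 * (D * recordDelta1 L (1 / 6) β) ^ 4) ≤ 12 * (L : ℝ) ^ 3 * (D * recordDelta1 L (1 / 6) β) ^ 4 := by ring_nf; exact le_rfl
  have hη := symEtaNear_le_atom (L := L) (K := btLog β) (ℓ := btLog β ^ 2) hβ0 hδ1 hl2 hx0.le hx1 hxl2_1 hβx (one_le_btLog β) hl12 hT2 hAT zero_le_one hα0 hα1 hσδ hΓ0 hΓ.le hN.le
  rw [← hC₁, ← hC₂] at hη
  exact hη.trans hs

/-- ★★ **The relative rate at schedule R is `O(λ_b²)`**: `κ₀ = β|E|α²(6t + 2T)² + 120η_s²` with `t = R = xℓ`, `α = xℓ²/(2L²)`, `T = 9L(5xℓ²) + ε`, `Γ = ε|Site|`, `σ = 12L³δ⁴` at the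
window `δ = D·recordDelta1 L (1/6)` satisfies `κ₀ ≤ a·bareLambda(L³β)²` eventually (`a = a(L, D)` explicit; in truth `κ₀ = o(λ_b²)`). [folklore] -/
theorem eventually_symKappaR_le_bareLambda_sq {D : ℝ} (hD : 1 ≤ D) :
    ∃ a : ℝ, ∀ᶠ β : ℝ in atTop,
      β * (Fintype.card (Edge 3 L) : ℝ) * (powScale (1 / 2) β * btLog β ^ 2 / (2 * (L : ℝ) ^ 2)) ^ 2 *
            (6 * (btLog β * powScale (1 / 2) β) + 2 * (9 * L * (5 * (powScale (1 / 2) β * btLog β ^ 2)) + btEps β)) ^ 2 +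
          120 * (β * ((Fintype.card (Edge 3 L) : ℝ) * (558 * (powScale (1 / 2) β * btLog β ^ 2 / (2 * (L : ℝ) ^ 2)) ^ 2 * (9 * L * (5 * (powScale (1 / 2) β * btLog β ^ 2)) + btEps β) ^ 2 +
              192 * (powScale (1 / 2) β * btLog β ^ 2 / (2 * (L : ℝ) ^ 2)) * (9 * L * (5 * (powScale (1 / 2) β * btLog β ^ 2)) + btEps β) ^ 2) +
              216 * (powScale (1 / 2) β * btLog β ^ 2 / (2 * (L : ℝ) ^ 2)) * (D * recordDelta1 L (1 / 6) β) * (btEps β * Fintype.card (Site 3 L))) +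
            β / 2 * (100 * ((L : ℝ) ^ 3 * (12 * (D * recordDelta1 L (1 / 6) β) ^ 4)) * (Fintype.card (Plaquette 3 L × Fin 3) : ℝ) * (btLog β * powScale (1 / 2) β) ^ 2 +
              10080 * (powScale (1 / 2) β * btLog β ^ 2 / (2 * (L : ℝ) ^ 2)) * (Fintype.card (Plaquette 3 L × Fin 3) : ℝ) * (btLog β * powScale (1 / 2) β) ^ 2 +
              (Fintype.card (Plaquette 3 L) : ℝ) * (58752 * (btLog β * powScale (1 / 2) β) ^ 3 + 1401138 * (btLog β * powScale (1 / 2) β) ^ 4 +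
                10000000 * (powScale (1 / 2) β * btLog β ^ 2 / (2 * (L : ℝ) ^ 2)) * (btLog β * powScale (1 / 2) β) ^ 2))) ^ 2 ≤
        a * bareLambda ((L : ℝ) ^ 3 * β) ^ 2 := by
  have hN : (0 : ℝ) < (Fintype.card (Site 3 L) : ℝ) := by exact_mod_cast Fintype.card_pos
  have hD0 : 0 < D := by linarith
  have hc40 : 0 < (14 * D / (Fintype.card (Site 3 L) : ℝ)) ^ 4 := by positivity
  have hc40' : 0 < ((Fintype.card (Site 3 L) : ℝ) / (14 * D)) ^ 4 := by positivity
  obtain ⟨a, ha⟩ : ∃ a : ℝ, a =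
      (240 * (600 * (Fintype.card (Plaquette 3 L × Fin 3) : ℝ) * (L : ℝ) ^ 3) ^ 2 +
          (9604 * (Fintype.card (Edge 3 L) : ℝ) * (L : ℝ) ^ 2 * 1 ^ 2 +
            240 * ((Fintype.card (Edge 3 L) : ℝ) * (558 * 1 ^ 2 * (2116 * (L : ℝ) ^ 2) + 192 * 1 * (2116 * (L : ℝ) ^ 2)) + 216 * 1 * (Fintype.card (Site 3 L) : ℝ) +
              5040 * 1 * (Fintype.card (Plaquette 3 L × Fin 3) : ℝ) + (Fintype.card (Plaquette 3 L) : ℝ) * (29376 + 700569 + 5000000 * 1)) ^ 2)) *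
        ((14 * D / Fintype.card (Site 3 L)) ^ 2 * L / (2 : ℝ) ^ ((1 : ℝ) / 3)) ^ 2 := ⟨_, rfl⟩
  refine ⟨a, ?_⟩
  have ht20 := (tendsto_powScale_mul_btLog_pow (show (0 : ℝ) < 1 / 3 by norm_num) 20).eventually (eventually_le_nhds hc40)
  have ht8 := (tendsto_powScale_mul_btLog_pow (show (0 : ℝ) < 2 / 3 by norm_num) 8).eventually (eventually_le_nhds hc40')
  filter_upwards [eventually_scheduleR_facts (L := L) hD, ht20, ht8] with β h hℓ20 hℓ8
  obtain ⟨hβ1, -, hℓ1, hδ0, -, hδhalf, hx0, hx1, hβx, hT0, hTx, -, hT2, -, -, -, -, -, -, hΓ, hα0, hαle, -, -, hxl2_1, -⟩ := h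
  have hβ0 : 0 ≤ β := by linarith
  have hℓ0 : 0 ≤ btLog β := by linarith
  have hl2 : (1 : ℝ) ≤ btLog β ^ 2 := one_le_pow₀ hℓ1
  have hl12 : btLog β ≤ btLog β ^ 2 := le_self_pow₀ hℓ1 (by norm_num)
  have hδ1 : D * recordDelta1 L (1 / 6) β ≤ 1 := by linarith
  have hΓ0 : 0 ≤ btEps β * (Fintype.card (Site 3 L) : ℝ) := mul_nonneg (powScale_pos _ _).le hN.le
  have hAT : (0 : ℝ) ≤ 2116 * (L : ℝ) ^ 2 := by positivity
  have hα1 : powScale (1 / 2) β * btLog β ^ 2 / (2 * (L : ℝ) ^ 2) ≤ 1 * powScale (1 / 2) β * btLog β ^ 2 := by rw [one_mul]; exact hαle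
  have hσδ : (L : ℝ) ^ 3 * (12 * (D * recordDelta1 L (1 / 6) β) ^ 4) ≤ 12 * (L : ℝ) ^ 3 * (D * recordDelta1 L (1 / 6) β) ^ 4 := by ring_nf; exact le_rfl
  have hσ0 : 0 ≤ (L : ℝ) ^ 3 * (12 * (D * recordDelta1 L (1 / 6) β) ^ 4) := by positivity
  have hη := symEtaNear_le_atom (L := L) (K := btLog β) (ℓ := btLog β ^ 2) hβ0 hδ1 hl2 hx0.le hx1 hxl2_1 hβx (one_le_btLog β) hl12 hT2 hAT zero_le_one hα0 hα1 hσδ hΓ0 hΓ.le hN.le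
  have hη0 := symEtaNear_nonneg (L := L) (T := 9 * L * (5 * (powScale (1 / 2) β * btLog β ^ 2)) + btEps β) hβ0 hδ0 hx0.le hℓ0 hα0 hσ0 hΓ0
  have hTx' : 9 * L * (5 * (powScale (1 / 2) β * btLog β ^ 2)) + btEps β ≤ 46 * L * powScale (1 / 2) β * btLog β ^ 2 := hTx
  have hκ := symKappaNear_le_atom (L := L) (K := btLog β) (ℓ := btLog β ^ 2) hβ0 hl2 hx0.le hβx hT0 hTx' hℓ0 hl12 hα0 hα1 hη0 hη
  rw [ha]
  have e8 : (D * recordDelta1 L (1 / 6) β) ^ 8 * (btLog β ^ 2) ^ 4 = (D * recordDelta1 L (1 / 6) β) ^ 4 * ((D * recordDelta1 L (1 / 6) β) ^ 4 * btLog β ^ 8) := by ring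
  have e20 : powScale (1 / 2) β ^ 2 * (btLog β ^ 2) ^ 10 = powScale (1 / 2) β ^ 2 * btLog β ^ 20 := by ring
  have y1 : (D * recordDelta1 L (1 / 6) β) ^ 8 * (btLog β ^ 2) ^ 4 ≤ (D * recordDelta1 L (1 / 6) β) ^ 4 := by
    rw [e8]; exact mul_le_of_le_one_right (by positivity) (delta_four_mul_log_pow_le_one (L := L) 8 hβ1 hD0 hℓ8)
  have y2 : powScale (1 / 2) β ^ 2 * (btLog β ^ 2) ^ 10 ≤ (D * recordDelta1 L (1 / 6) β) ^ 4 := by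
    rw [e20]; exact powScale_half_sq_mul_log_pow_le_delta_four' (L := L) 20 hβ1 hℓ20
  exact hκ.trans (symKappaNear_final_step (by positivity) y1 y2 (scaledDelta1_pow_four_eq (L := L) D hβ1))

end Summit.QuantumFields.YangMills.Theorems.FemtoTransferGap.TwoLattice.ConstTube

end
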